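import Summits.Ventures.YMGap.Census.PlaquetteForest
import Summits.Ventures.YMGap.Census.DecimationLowerBoundPlus
import Summits.Ventures.YMGap.Census.DecimationPositivity
import Summits.Ventures.YMGap.Census.OddTwistBound
import HarnessLib

/-!
# Venture YMGap, track (b) census — Tomboulis III.2 (3.7) and IV.4 (4.13) for EVERY decimation parameter `b ≥ 2`
# (in particular `b = 2` in `d = 3, 4, 5`) on the positivity domain, by the axial-gauge forest bound

HONEST FRAMING: venture file of the cell `pub-ymgap` (QuantumFields programme).  Exact statements about the finite tori
`(ℤ/bLℤ)^d → (ℤ/Lℤ)^d`, `d ≥ 3`, coarse side `L ≥ 2`, `bL` even; nothing about (5.15), confinement or any limit.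

Tomboulis (arXiv:0707.2179, Prop. III.2 eq. (3.7), Prop. IV.4 eq. (4.13); proof App. A §3):
`Z_{Λ^{(n)}}({c_j(n-1)^6}) ≤ Z_{Λ^{(n-1)}}({c_j(n-1)})` and the same for `Z⁺`.  The tree had these
(`DecimationLowerBound`, `DecimationLowerBoundPlus`) only where the crude sup bound `Z_{(ℤ/L)^d} ≤ f(1)^{#plaquettes}` meets the
certified (2.13)-exponent `(bL)^d/4`, i.e. for `2d(d-1) ≤ b^d` — NOT for `b = 2` in `d = 3, 4, 5`.  Here the sup bound is replaced by
`PlaquetteForest.torusZ_le_pow_card_sub_card_forest`: the `#𝔉` plaquettes of the axial-gauge forest integrate to one exactly, so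
only `#plaquettes - #𝔉` factors are bounded by `f(1)`; and `4(#plaquettes - #𝔉) ≤ (2L)^d` on every torus of side `L ≥ 2` in
`d ≥ 3` (`four_mul_card_sub_forest_le`; at `d = 4`, `L = 2` the two lowest stages of `𝔉` used in the count have `32` members and
`4 · (96 - 32) = 256 = (2·2)^4` exactly; the full forest has `34` members there).
The price is the positivity domain `f_c ≥ 0` (needed to bound the non-forest factors from above inside the integral), exactly the
hypothesis of the tree's III.1 rows (`Decimation.decimationUpperBound_of_nonneg`); `f_{c^6} ≥ 0` follows from `f_c ≥ 0`
(`DecimationPositivity.plaqFn_pow_coeff_nonneg`, convolution on `SU(2)`).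

* counting: `card_filter_coords_eq` (`#{x : x|_A = v} = L^{d - #A}`), `card_filter_planes_fst_eq` (`#{(i,j) : i < j, i = i₀} = d-1-i₀`),
  `stageZero_card`, `stageOne_card`, **`le_card_axialForest`** (`#𝔉 + (d-1)L^{d-1} + (d-2)L^{d-2} ≥ (d-1)L^d + (d-2)L^{d-1}`),
  **`four_mul_card_sub_forest_le`** (`4(#plaquettes - #𝔉) ≤ (2L)^d`, `d ≥ 3`, `L ≥ 2`).
* **`decimationLowerBound_of_nonneg`** — III.2: `Z_{(ℤ/L)^d}({c_j^6}) ≤ Z_{(ℤ/bL)^d}({c_j})` for every `b ≥ 2`, `d ≥ 3`, `L ≥ 2`,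
  `bL` even, every `J`, every admissible `c` with `f_c ≥ 0`; instances `decimationLowerBound_two_of_nonneg` (`b = 2`, every `L ≥ 2`).
* **`decimationLowerBoundPlus_of_nonneg'`** — IV.4 likewise for `Z⁺` on the vortex sheet `𝒱_{ij}`, every plane.
NOT CLAIMED: the typed `Tomboulis2007.DecimationLowerBound d L 2 J` over ALL admissible `c` (sign-changing truncated `f`).
[cite: Tomboulis2007Confinement, Prop. III.2 eq. (3.7), Prop. IV.4 eq. (4.13); App. A §3]
-/

noncomputable section

open MeasureTheory Finset Real Function
open scoped BigOperators
open Literature.MathematicalPhysics.QuantumLattice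
open Literature.MathematicalPhysics.QuantumFieldTheory
open Literature.MathematicalPhysics.QuantumFieldTheory.Tomboulis2007
open Literature.MathematicalPhysics.QuantumFieldTheory.WilsonRP

namespace Summit.Ventures.YMGap.Census

variable {d L : ℕ} [NeZero L]

/-! ### Counting sites with prescribed coordinates -/

/-- **Sites with prescribed coordinates**: `#{x ∈ (ℤ/L)^d : x_k = v_k ∀ k ∈ A} = L^{d - #A}`. [folklore] -/
theorem card_filter_coords_eq (A : Finset (Fin d)) (v : Fin d → ZMod L) :
    (univ.filter fun x : Site d L => ∀ k ∈ A, x k = v k).card = L ^ (d - A.card) := by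
  let e : {x : Site d L // ∀ k ∈ A, x k = v k} ≃ ({k : Fin d // k ∉ A} → ZMod L) :=
    { toFun := fun x k => x.1 k
      invFun := fun y => ⟨fun k => if h : k ∈ A then v k else y ⟨k, h⟩, fun k hk => by simp [hk]⟩
      left_inv := by
        rintro ⟨x, hx⟩
        apply Subtype.ext
        funext k
        by_cases hk : k ∈ A
        · simp [hk, hx k hk]
        · simp [hk]
      right_inv := by
        intro y
        funext k
        simp [k.2] }
  rw [← Fintype.card_subtype, Fintype.card_congr e, Fintype.card_fun, ZMod.card, Fintype.card_subtype_compl,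
    Fintype.card_fin, Fintype.card_coe]

/-- One prescribed coordinate: `#{x : x_i = a} = L^{d-1}`. [folklore] -/
theorem card_filter_apply_eq (i : Fin d) (a : ZMod L) :
    (univ.filter fun x : Site d L => x i = a).card = L ^ (d - 1) := by
  have h := card_filter_coords_eq (L := L) ({i} : Finset (Fin d)) (fun _ => a)
  rw [card_singleton] at h
  rw [← h]
  congr 1
  ext x
  simp

/-- Two prescribed coordinates: `#{x : x_i = a, x_{i'} = a'} = L^{d-2}` (`i ≠ i'`). [folklore] -/
theorem card_filter_apply_eq_two {i i' : Fin d} (hii' : i ≠ i') (a a' : ZMod L) :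
    (univ.filter fun x : Site d L => x i = a ∧ x i' = a').card = L ^ (d - 2) := by
  have h := card_filter_coords_eq (L := L) ({i, i'} : Finset (Fin d)) (fun k => if k = i then a else a')
  rw [card_pair hii'] at h
  rw [← h]
  congr 1
  ext x
  simp only [mem_filter, mem_univ, true_and, mem_insert, mem_singleton, forall_eq_or_imp, forall_eq, if_true,
    if_neg (Ne.symm hii')]

/-- `#{x : x_i ≠ L-1} + L^{d-1} = L^d`. [folklore] -/
theorem card_filter_add_one_ne (i : Fin d) :
    (univ.filter fun x : Site d L => x i + 1 ≠ 0).card + L ^ (d - 1) = L ^ d := by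
  have h1 : (univ.filter fun x : Site d L => x i + 1 ≠ 0) = univ.filter fun x : Site d L => ¬ (x i = -1) :=
    filter_congr fun x _ => by rw [Ne, add_eq_zero_iff_eq_neg]
  rw [h1, ← card_filter_apply_eq (L := L) i (-1), add_comm, card_filter_add_card_filter_not, card_univ, Fintype.card_fun,
    ZMod.card, Fintype.card_fin]

/-- `#{x : x_{i₀} = 0, x_{i₁} ≠ L-1} + L^{d-2} = L^{d-1}` (`i₀ ≠ i₁`). [folklore] -/
theorem card_filter_zero_add_one_ne {i₀ i₁ : Fin d} (h01 : i₀ ≠ i₁) :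
    (univ.filter fun x : Site d L => x i₀ = 0 ∧ x i₁ + 1 ≠ 0).card + L ^ (d - 2) = L ^ (d - 1) := by
  have hsplit : (univ.filter fun x : Site d L => x i₀ = 0 ∧ x i₁ + 1 ≠ 0) =
      (univ.filter fun x : Site d L => x i₀ = 0) \ (univ.filter fun x : Site d L => x i₀ = 0 ∧ x i₁ = -1) := by
    ext x
    simp only [mem_filter, mem_univ, true_and, mem_sdiff, not_and, ne_eq, add_eq_zero_iff_eq_neg]
    tauto
  have hsub : (univ.filter fun x : Site d L => x i₀ = 0 ∧ x i₁ = -1) ⊆ (univ.filter fun x : Site d L => x i₀ = 0) :=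
    fun x hx => by
      simp only [mem_filter, mem_univ, true_and] at hx ⊢
      exact hx.1
  rw [hsplit, card_sdiff_of_subset hsub, card_filter_apply_eq, card_filter_apply_eq_two h01,
    Nat.sub_add_cancel]
  have := card_le_card hsub
  rwa [card_filter_apply_eq, card_filter_apply_eq_two h01] at this

/-! ### Counting plane pairs with a given first direction -/

omit [NeZero L] in
/-- `#{(i, j) : i < j, i = i₀} = d - 1 - i₀`. [folklore] -/
theorem card_filter_planes_fst_eq (i₀ : Fin d) :
    (univ.filter fun s : {q : Fin d × Fin d // q.1 < q.2} => s.1.1 = i₀).card = d - 1 - (i₀ : ℕ) := by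
  rw [← Fin.card_Ioi i₀]
  refine card_bij (fun s _ => s.1.2) (fun s hs => ?_) (fun s hs t ht h => ?_) (fun j hj => ?_)
  · simp only [mem_filter, mem_univ, true_and] at hs
    rw [mem_Ioi, ← hs]
    exact s.2
  · simp only [mem_filter, mem_univ, true_and] at hs ht
    exact Subtype.ext (Prod.ext (hs.trans ht.symm) h)
  · rw [mem_Ioi] at hj
    exact ⟨⟨(i₀, j), hj⟩, by simp, rfl⟩

/-! ### The two lowest stages of the forest -/

section Stages

variable (L)

/-- Stage `0` of the forest: planes `(i₀, ν)` with `i₀ = 0`, base points with `x_{i₀} ≠ L-1`. -/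
theorem stageZero_subset {i₀ : Fin d} (hi₀ : (i₀ : ℕ) = 0) :
    (univ.filter fun p : Plaquette d L => p.1 i₀ + 1 ≠ 0 ∧ p.2.1.1 = i₀) ⊆ axialForest d L := by
  intro p hp
  simp only [mem_filter, mem_univ, true_and] at hp
  rw [mem_axialForest, hp.2]
  refine ⟨fun k hk => ?_, hp.1⟩
  exact absurd (Fin.lt_def.1 hk) (by rw [hi₀]; exact Nat.not_lt_zero _)

/-- Stage `1` of the forest: planes `(i₁, ν)` with `i₁ = 1`, base points with `x_{i₀} = 0`, `x_{i₁} ≠ L-1`. -/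
theorem stageOne_subset {i₀ i₁ : Fin d} (hi₀ : (i₀ : ℕ) = 0) (hi₁ : (i₁ : ℕ) = 1) :
    (univ.filter fun p : Plaquette d L => (p.1 i₀ = 0 ∧ p.1 i₁ + 1 ≠ 0) ∧ p.2.1.1 = i₁) ⊆ axialForest d L := by
  intro p hp
  simp only [mem_filter, mem_univ, true_and] at hp
  rw [mem_axialForest, hp.2]
  refine ⟨fun k hk => ?_, hp.1.2⟩
  have hk0 : (k : ℕ) = 0 := by have := Fin.lt_def.1 hk; omega
  have hki : k = i₀ := Fin.ext (by rw [hk0, hi₀])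
  rw [hki]
  exact hp.1.1

/-- `#stage 0 + (d-1)L^{d-1} = (d-1)L^d`. -/
theorem stageZero_card {i₀ : Fin d} (hi₀ : (i₀ : ℕ) = 0) :
    (univ.filter fun p : Plaquette d L => p.1 i₀ + 1 ≠ 0 ∧ p.2.1.1 = i₀).card + (d - 1) * L ^ (d - 1) =
      (d - 1) * L ^ d := by
  have hS : (univ.filter fun p : Plaquette d L => p.1 i₀ + 1 ≠ 0 ∧ p.2.1.1 = i₀) =
      (univ.filter fun y : Site d L => y i₀ + 1 ≠ 0) ×ˢ
        (univ.filter fun s : {q : Fin d × Fin d // q.1 < q.2} => s.1.1 = i₀) := by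
    ext p
    simp only [mem_filter, mem_univ, true_and, mem_product]
  rw [hS, card_product, card_filter_planes_fst_eq, hi₀, Nat.sub_zero, mul_comm, ← Nat.mul_add, card_filter_add_one_ne]

/-- `#stage 1 + (d-2)L^{d-2} = (d-2)L^{d-1}`. -/
theorem stageOne_card {i₀ i₁ : Fin d} (hi₀ : (i₀ : ℕ) = 0) (hi₁ : (i₁ : ℕ) = 1) :
    (univ.filter fun p : Plaquette d L => (p.1 i₀ = 0 ∧ p.1 i₁ + 1 ≠ 0) ∧ p.2.1.1 = i₁).card + (d - 2) * L ^ (d - 2) =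
      (d - 2) * L ^ (d - 1) := by
  have h01 : i₀ ≠ i₁ := fun h => by have := congrArg Fin.val h; rw [hi₀, hi₁] at this; exact absurd this (by norm_num)
  have hS : (univ.filter fun p : Plaquette d L => (p.1 i₀ = 0 ∧ p.1 i₁ + 1 ≠ 0) ∧ p.2.1.1 = i₁) =
      (univ.filter fun y : Site d L => y i₀ = 0 ∧ y i₁ + 1 ≠ 0) ×ˢ
        (univ.filter fun s : {q : Fin d × Fin d // q.1 < q.2} => s.1.1 = i₁) := by
    ext p
    simp only [mem_filter, mem_univ, true_and, mem_product]
  rw [hS, card_product, card_filter_planes_fst_eq, hi₁, show d - 1 - 1 = d - 2 by omega, mul_comm, ← Nat.mul_add,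
    card_filter_zero_add_one_ne h01]

/-- **The forest has at least its two lowest stages**:
`#𝔉 + (d-1)L^{d-1} + (d-2)L^{d-2} ≥ (d-1)L^d + (d-2)L^{d-1}` (`d ≥ 2`). -/
theorem le_card_axialForest (hd : 2 ≤ d) :
    (d - 1) * L ^ d + (d - 2) * L ^ (d - 1) ≤
      (axialForest d L).card + (d - 1) * L ^ (d - 1) + (d - 2) * L ^ (d - 2) := by
  let i₀ : Fin d := ⟨0, by omega⟩
  let i₁ : Fin d := ⟨1, by omega⟩
  have hi₀ : (i₀ : ℕ) = 0 := rfl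
  have hi₁ : (i₁ : ℕ) = 1 := rfl
  have h01 : i₀ ≠ i₁ := fun h => absurd (congrArg Fin.val h) (by norm_num [hi₀, hi₁])
  have hdisj : Disjoint (univ.filter fun p : Plaquette d L => p.1 i₀ + 1 ≠ 0 ∧ p.2.1.1 = i₀)
      (univ.filter fun p : Plaquette d L => (p.1 i₀ = 0 ∧ p.1 i₁ + 1 ≠ 0) ∧ p.2.1.1 = i₁) := by
    rw [disjoint_filter]
    intro p _ h0 h1
    exact h01 (h0.2.symm.trans h1.2)
  have hcard : (univ.filter fun p : Plaquette d L => p.1 i₀ + 1 ≠ 0 ∧ p.2.1.1 = i₀).card +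
      (univ.filter fun p : Plaquette d L => (p.1 i₀ = 0 ∧ p.1 i₁ + 1 ≠ 0) ∧ p.2.1.1 = i₁).card ≤
        (axialForest d L).card := by
    rw [← card_union_of_disjoint hdisj]
    exact card_le_card (union_subset (stageZero_subset L hi₀) (stageOne_subset L hi₀ hi₁))
  have h0 := stageZero_card L hi₀
  have h1 := stageOne_card L hi₀ hi₁
  calc (d - 1) * L ^ d + (d - 2) * L ^ (d - 1)
      = ((univ.filter fun p : Plaquette d L => p.1 i₀ + 1 ≠ 0 ∧ p.2.1.1 = i₀).card + (d - 1) * L ^ (d - 1)) +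
          ((univ.filter fun p : Plaquette d L => (p.1 i₀ = 0 ∧ p.1 i₁ + 1 ≠ 0) ∧ p.2.1.1 = i₁).card +
            (d - 2) * L ^ (d - 2)) := by rw [h0, h1]
    _ = ((univ.filter fun p : Plaquette d L => p.1 i₀ + 1 ≠ 0 ∧ p.2.1.1 = i₀).card +
          (univ.filter fun p : Plaquette d L => (p.1 i₀ = 0 ∧ p.1 i₁ + 1 ≠ 0) ∧ p.2.1.1 = i₁).card) +
          (d - 1) * L ^ (d - 1) + (d - 2) * L ^ (d - 2) := by ring
    _ ≤ (axialForest d L).card + (d - 1) * L ^ (d - 1) + (d - 2) * L ^ (d - 2) := by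
        gcongr

/-! ### The arithmetic: `4(#plaquettes - #𝔉) ≤ (2L)^d` -/

omit [NeZero L] in
/-- `2n + 6 ≤ 2^{n+2}` for `n ≥ 3`. [folklore] -/
theorem two_mul_add_six_le_two_pow {n : ℕ} (hn : 3 ≤ n) : 2 * n + 6 ≤ 2 ^ (n + 2) := by
  induction n, hn using Nat.le_induction with
  | base => norm_num
  | succ m hm ih =>
    have h2 : 2 ≤ 2 ^ (m + 2) := by
      calc (2 : ℕ) = 2 ^ 1 := by norm_num
        _ ≤ 2 ^ (m + 2) := Nat.pow_le_pow_right (by norm_num) (by omega)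
    calc 2 * (m + 1) + 6 = (2 * m + 6) + 2 := by ring
      _ ≤ 2 ^ (m + 2) + 2 ^ (m + 2) := Nat.add_le_add ih h2
      _ = 2 ^ (m + 1 + 2) := by ring

omit [NeZero L] in
/-- `e² + 5e + 6 ≤ 2^{e+2}` for `e ≥ 3`. [folklore] -/
theorem sq_add_le_two_pow {e : ℕ} (he : 3 ≤ e) : e ^ 2 + 5 * e + 6 ≤ 2 ^ (e + 2) := by
  induction e, he using Nat.le_induction with
  | base => norm_num
  | succ n hn ih =>
    calc (n + 1) ^ 2 + 5 * (n + 1) + 6 = (n ^ 2 + 5 * n + 6) + (2 * n + 6) := by ring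
      _ ≤ 2 ^ (n + 2) + 2 ^ (n + 2) := Nat.add_le_add ih (two_mul_add_six_le_two_pow hn)
      _ = 2 ^ (n + 1 + 2) := by ring

omit [NeZero L] in
/-- The polynomial inequality behind the count: `2(e+2)(e+1)M² + 4M + 4(e+1) ≤ 2^{e+3} M²` for `M ≥ 2`. [folklore] -/
theorem key_poly_ineq (e M : ℕ) (hM : 2 ≤ M) :
    2 * (e + 2) * (e + 1) * M ^ 2 + 4 * M + 4 * (e + 1) ≤ 2 ^ (e + 3) * M ^ 2 := by
  have hMM : 2 * M ≤ M ^ 2 := by rw [pow_two]; exact Nat.mul_le_mul_right M hM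
  rcases Nat.lt_or_ge e 3 with he | he
  · interval_cases e <;> norm_num <;> nlinarith [hMM, hM]
  · have h1 := sq_add_le_two_pow he
    have hM2 : M ≤ M ^ 2 := by nlinarith
    have hM1 : 1 ≤ M ^ 2 := by nlinarith
    calc 2 * (e + 2) * (e + 1) * M ^ 2 + 4 * M + 4 * (e + 1)
        ≤ 2 * (e + 2) * (e + 1) * M ^ 2 + 4 * M ^ 2 + 4 * (e + 1) * M ^ 2 := by nlinarith
      _ = 2 * (e ^ 2 + 5 * e + 6) * M ^ 2 := by ring
      _ ≤ 2 * 2 ^ (e + 2) * M ^ 2 := by gcongr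
      _ = 2 ^ (e + 3) * M ^ 2 := by ring

/-- **`4 · (#plaquettes((ℤ/L)^d) - #𝔉) ≤ (2L)^d`** for `d ≥ 3`, `L ≥ 2` (equality of the two lowest stages' count with
`2^d L^d / 4` happens at `d = 4`, `L = 2`). -/
theorem four_mul_card_sub_forest_le (hd : 3 ≤ d) (hL : 2 ≤ L) :
    4 * (Fintype.card (Plaquette d L) - (axialForest d L).card) ≤ (2 * L) ^ d := by
  obtain ⟨e, rfl⟩ : ∃ e, d = e + 3 := ⟨d - 3, by omega⟩
  have hF := le_card_axialForest L (d := e + 3) (by omega)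
  have h2 := two_mul_card_plaquette (d := e + 3) (L := L)
  have hkey := key_poly_ineq e L hL
  simp only [show e + 3 - 1 = e + 2 by omega, show e + 3 - 2 = e + 1 by omega] at hF h2
  have hFP : (axialForest (e + 3) L).card ≤ Fintype.card (Plaquette (e + 3) L) := card_axialForest_le
  obtain ⟨k, hk⟩ := Nat.exists_eq_add_of_le hFP
  rw [hk, Nat.add_sub_cancel_left]
  rw [hk] at h2
  -- everything in terms of `C = L^{e+1}`: `L^{e+3} = L²C`, `L^{e+2} = LC`, `(2L)^{e+3} = 2^{e+3} L² C`
  have hA : L ^ (e + 3) = L ^ 2 * L ^ (e + 1) := by ring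
  have hB : L ^ (e + 2) = L * L ^ (e + 1) := by ring
  have h2L : (2 * L) ^ (e + 3) = 2 ^ (e + 3) * L ^ 2 * L ^ (e + 1) := by rw [mul_pow, hA]; ring
  rw [hA, hB] at hF
  rw [hA] at h2
  rw [h2L]
  have hkeyC : (2 * (e + 2) * (e + 1) * L ^ 2 + 4 * L + 4 * (e + 1)) * L ^ (e + 1) ≤
      2 ^ (e + 3) * L ^ 2 * L ^ (e + 1) := by
    have := Nat.mul_le_mul_right (L ^ (e + 1)) hkey
    simpa [mul_assoc] using this
  -- linear bookkeeping in the monomials after normalisation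
  set F := (axialForest (e + 3) L).card with hFdef
  set C := L ^ (e + 1) with hCdef
  ring_nf at hF h2 hkeyC ⊢
  nlinarith [hF, h2, hkeyC]

/-! ### III.2 and IV.4 for every `b ≥ 2` on the positivity domain -/

section Assembly

variable {L}
variable [Fact (1 < L)]

/-- `f_{c^6} ≥ 0` on the positivity domain (`c^6 = c^5 · c`, convolution positivity). -/
theorem plaqFn_lowerCoeff_nonneg {J : ℕ} {c : ℕ → ℝ} (hf : ∀ g : SU2, 0 ≤ plaqFn J c g) (g : SU2) :
    0 ≤ plaqFn J (lowerCoeff c) g :=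
  plaqFn_pow_coeff_nonneg hf 5 g

/-- The forest exponent is below the certified (2.13) exponent of the fine torus: `#plaq((ℤ/L)^d) - #𝔉 ≤ (bL)^d/4`
(`d ≥ 3`, `L ≥ 2`, `b ≥ 2`). -/
theorem card_sub_forest_le_quarter (hd : 3 ≤ d) {b : ℕ} (hb : 2 ≤ b) :
    Fintype.card (Plaquette d L) - (axialForest d L).card ≤ (b * L) ^ d / 4 := by
  have hL : 2 ≤ L := (Fact.out : 1 < L)
  have h4 := four_mul_card_sub_forest_le L hd hL
  have hmono : (2 * L) ^ d ≤ (b * L) ^ d := Nat.pow_le_pow_left (Nat.mul_le_mul_right L hb) d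
  refine (Nat.le_div_iff_mul_le (by norm_num)).2 ?_
  rw [mul_comm]
  exact h4.trans hmono

/-- **Tomboulis III.2 (3.7) for every `b ≥ 2` on the positivity domain**: on `d ≥ 3`, coarse side `L ≥ 2`, `bL` even, every spin
cut-off `J`, every admissible `{c_j}` with `f_c ≥ 0` pointwise:
`Z_{(ℤ/Lℤ)^d}({c_j^6}) ≤ Z_{(ℤ/bLℤ)^d}({c_j})`.  NEW for `b = 2` in `d = 3, 4, 5`.
[cite: Tomboulis2007Confinement, Prop. III.2 eq. (3.7); App. A §3] -/
theorem decimationLowerBound_of_nonneg (hd : 3 ≤ d) {b : ℕ} (hb : 2 ≤ b) [NeZero (b * L)] (hbL : Even (b * L)) (J : ℕ)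
    {c : ℕ → ℝ} (hc : CoeffAdmissible c) (hf : ∀ g : SU2, 0 ≤ plaqFn J c g) :
    torusZ d L J (lowerCoeff c) ≤ torusZ d (b * L) J c := by
  have hc6 : ∀ n, 1 ≤ n → 0 ≤ lowerCoeff c n := fun n hn => pow_nonneg (hc n hn).1 6
  calc torusZ d L J (lowerCoeff c)
      ≤ (1 + ∑ n ∈ Icc 1 J, ((n : ℝ) + 1) ^ 2 * lowerCoeff c n) ^
          (Fintype.card (Plaquette d L) - (axialForest d L).card) :=
        torusZ_le_pow_card_sub_card_forest J hc6 (plaqFn_lowerCoeff_nonneg hf)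
    _ = (1 + ∑ n ∈ Icc 1 J, ((n : ℝ) + 1) ^ 2 * c n ^ 6) ^ (Fintype.card (Plaquette d L) - (axialForest d L).card) := rfl
    _ ≤ (1 + ∑ n ∈ Icc 1 J, ((n : ℝ) + 1) ^ 2 * c n ^ 6) ^ ((b * L) ^ d / 4) :=
        pow_le_pow_right₀ (one_le_hypercubeBase J c) (card_sub_forest_le_quarter hd hb)
    _ ≤ torusZ d (b * L) J c := hypercubeLowerBoundExp_quarter hd hbL J c hc

/-- **III.2 at `b = 2`**: `Z_{(ℤ/L)^d}({c_j^6}) ≤ Z_{(ℤ/2L)^d}({c_j})` for every `d ≥ 3`, every `L ≥ 2`, every `J`, on the positivity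
domain — the decimations `4³ → 2³`, `4⁴ → 2⁴`, `6³ → 3³`, … of the census. [cite: Tomboulis2007Confinement, Prop. III.2 eq. (3.7)] -/
theorem decimationLowerBound_two_of_nonneg (hd : 3 ≤ d) (J : ℕ) {c : ℕ → ℝ} (hc : CoeffAdmissible c)
    (hf : ∀ g : SU2, 0 ≤ plaqFn J c g) :
    torusZ d L J (lowerCoeff c) ≤ torusZ d (2 * L) J c :=
  decimationLowerBound_of_nonneg hd le_rfl (even_two_mul L) J hc hf

/-- **Tomboulis IV.4 (4.13) for every `b ≥ 2` on the positivity domain**: on `d ≥ 3`, coarse side `L ≥ 2`, `bL` even, every plane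
`i < j`, every `J`, every admissible `{c_j}` with `f_c ≥ 0`:
`Z⁺_{(ℤ/Lℤ)^d}({c_j^6}; 𝒱_{ij}) ≤ Z⁺_{(ℤ/bLℤ)^d}({c_j}; 𝒱_{ij})` — via `Z⁺ ≤ Z` on the coarse torus (`|Z⁻| ≤ Z`,
`OddTwistBound.abs_torusZtw_vortexSheet_le_torusZ_of_plaqFn_nonneg`), the forest bound, and IV.2 (ii)
(`torusZplus_lowerBound_quarter`).  NEW for `b = 2` in `d = 3, 4, 5`.
[cite: Tomboulis2007Confinement, Prop. IV.4 eq. (4.13); App. A §3] -/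
theorem decimationLowerBoundPlus_of_nonneg' (hd : 3 ≤ d) {b : ℕ} (hb : 2 ≤ b) [NeZero (b * L)] (hbL : Even (b * L)) (J : ℕ)
    {i j : Fin d} (hij : i < j) {c : ℕ → ℝ} (hc : CoeffAdmissible c) (hf : ∀ g : SU2, 0 ≤ plaqFn J c g) :
    torusZplus d L J (lowerCoeff c) (vortexSheet L i j hij) ≤ torusZplus d (b * L) J c (vortexSheet (b * L) i j hij) := by
  haveI : NeZero d := ⟨by omega⟩
  have h01 : (0 : Fin d) < 1 := by
    rw [Fin.lt_def, Fin.val_zero, Fin.val_one', Nat.one_mod_eq_one.mpr (by omega)]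
    exact Nat.zero_lt_one
  have hc6 : ∀ n, 1 ≤ n → 0 ≤ lowerCoeff c n := fun n hn => pow_nonneg (hc n hn).1 6
  have hf6 : ∀ g : SU2, 0 ≤ plaqFn J (lowerCoeff c) g := plaqFn_lowerCoeff_nonneg hf
  have htw : torusZtw d L J (lowerCoeff c) (vortexSheet L i j hij) ≤ torusZ d L J (lowerCoeff c) :=
    (le_abs_self _).trans (abs_torusZtw_vortexSheet_le_torusZ_of_plaqFn_nonneg h01 J hc6 hf6 hij)
  have hplus : torusZplus d L J (lowerCoeff c) (vortexSheet L i j hij) ≤ torusZ d L J (lowerCoeff c) := by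
    unfold torusZplus
    linarith
  calc torusZplus d L J (lowerCoeff c) (vortexSheet L i j hij)
      ≤ torusZ d L J (lowerCoeff c) := hplus
    _ ≤ (1 + ∑ n ∈ Icc 1 J, ((n : ℝ) + 1) ^ 2 * lowerCoeff c n) ^
          (Fintype.card (Plaquette d L) - (axialForest d L).card) :=
        torusZ_le_pow_card_sub_card_forest J hc6 hf6
    _ = (1 + ∑ n ∈ Icc 1 J, ((n : ℝ) + 1) ^ 2 * c n ^ 6) ^ (Fintype.card (Plaquette d L) - (axialForest d L).card) := rfl
    _ ≤ (1 + ∑ n ∈ Icc 1 J, ((n : ℝ) + 1) ^ 2 * c n ^ 6) ^ ((b * L) ^ d / 4) :=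
        pow_le_pow_right₀ (one_le_hypercubeBase J c) (card_sub_forest_le_quarter hd hb)
    _ ≤ torusZplus d (b * L) J c (vortexSheet (b * L) i j hij) := torusZplus_lowerBound_quarter hd hbL J hij hc

/-- **IV.4 at `b = 2`**, every `d ≥ 3`, `L ≥ 2`, plane, `J`, on the positivity domain. [cite: Tomboulis2007Confinement, Prop. IV.4 eq. (4.13)] -/
theorem decimationLowerBoundPlus_two_of_nonneg (hd : 3 ≤ d) (J : ℕ) {i j : Fin d} (hij : i < j) {c : ℕ → ℝ}
    (hc : CoeffAdmissible c) (hf : ∀ g : SU2, 0 ≤ plaqFn J c g) :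
    torusZplus d L J (lowerCoeff c) (vortexSheet L i j hij) ≤ torusZplus d (2 * L) J c (vortexSheet (2 * L) i j hij) :=
  decimationLowerBoundPlus_of_nonneg' hd le_rfl (even_two_mul L) J hij hc hf

end Assembly

end Stages

end Summit.Ventures.YMGap.Census

end
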